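import Mathlib
import Summits.ValiantsHypothesis.ValiantsHypothesis.Theses.GrenetZeon
import Summits.ValiantsHypothesis.ValiantsHypothesis.Theorems.GrenetZeonTwoDimCoefficientsDefs
import Summits.ValiantsHypothesis.ValiantsHypothesis.Theorems.GrenetZeonTwoDimCoefficientsDualUnipotentUnfolding

/-!
# `GrenetZeon.DualUnipotentThreeHalves` (stmt-ValiantsHypothesis-24318), line «wild_portrait» head U:
# the stub U2 `CheapIndexMass` acts on the rung ONLY through width saving `≤ C`

Negative-lane bookkeeping for the 3/2 rung (refuter val-neg-2, 2026-08-28).  The line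
`Cruxes/DualUnipotentThreeHalves/Lines/wild_portrait.lean` (val-idea-9) closes the rung from its crux U2
`WildUnfold.CheapIndexMass`

  `∃ C n₀, ∀ n ≥ n₀, ∀ m, DualUnipotentRepr n m → ∃ N M lev r, (N M affine ∧ per_n = tr(N^{n−1} M) ∧ N block-upper for lev ∧`
  `∀ l, (diagBlock N lev l)^{r l} = 0) ∧ Σ_u r(lev u) ≤ C·m`

("every unipotent-dual representation of `per_n` of width `m` can be RE-REPRESENTED AT THE SAME WIDTH `m` in a block form of
index mass `≤ C·m`").  This file records, kernel-side, that the deciding chain consumes U2 only through the WEAKER statement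

  U2′ (`StrictUpperWidthSaving`, inlined): `∃ C n₀, ∀ n ≥ n₀, ∀ m, DualUnipotentRepr n m → ∃ m′ ≤ C·m, StrictUpperRepr n m′`

("a wild = non-triangularisable representation saves AT MOST A CONSTANT FACTOR in width over the strictly upper triangular
= skew-circuit class"):

* `strictUpperWidthSaving_of_cheapIndexMass` : U2 → U2′ — the landed unfolding `exists_strictUpper_unfolding` (U1) turns the
  block form of index mass `I ≤ C·m` into a strictly upper triangular representation of width `I`;
* `dualUnipotentThreeHalves_of_strictUpperWidthSaving` : U2′ → rung — the landed triangularisable rung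
  (`cube_le_of_strictLevel`, `n³ ≤ 144·m′²`) and `m′ ≤ C·m`;
* `dualUnipotentThreeHalves_of_cheapIndexMass'` : U2 → rung, the composite (the skeleton's chain, Theorems-side).

So the SAME-WIDTH re-blocking demanded by U2 is an extra failure mode that the rung never uses: a planner may re-cut the crux
to U2′ (strictly weaker as stated; whether U2′ → U2 holds is open and not claimed here).  Refuter's reading of U2′: with
`m_DU(n)` the least unipotent-dual width and `T(n)` the least strictly-upper width of `per_n`, U2′ says `T(n) ≤ C·m_DU(n)`
for `n ≥ n₀`; its negation needs `per_n`-specific wild representations beating every triangular one by a super-constant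
factor — not available by cheap means (the `∃ C ∃ n₀` escape absorbs every finite family), so U2 / U2′ SURVIVE the
refuter pass; this file is a portrait of what they assert, not evidence for or against them.

HONEST FRAMING: nothing here proves or refutes U2, U2′, the rung 24318, the crux 8062, or moves `VP ≠ VNP`.
-/

set_option linter.dupNamespace false
set_option autoImplicit false

noncomputable section

namespace Summit.ValiantsHypothesis.ValiantsHypothesis.Theorems.DualUnipotentThreeHalvesNegative

open MvPolynomial Matrix
open scoped BigOperators
open Literature.Computability.AlgebraicComplexity
open Summit.ValiantsHypothesis.ValiantsHypothesis.Cruxes.TwoDimCoefficients.DimTwoCases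
  (AffMat IsAffine DualUnipotentRepr diagBlock exists_strictUpper_unfolding cube_le_of_strictLevel)
open Summit.ValiantsHypothesis.ValiantsHypothesis.Theses.GrenetZeon (DualUnipotentThreeHalves)

/-- **U2 → U2′.**  Cheap index mass gives width saving `≤ C`: unfold the block form (landed U1
`exists_strictUpper_unfolding`) into a strictly upper triangular representation of width `Σ_u r(lev u) ≤ C·m`. [folklore] -/
theorem strictUpperWidthSaving_of_cheapIndexMass
    (h : ∃ C n₀ : ℕ, ∀ n ≥ n₀, ∀ m : ℕ, DualUnipotentRepr n m →
      ∃ (N M : AffMat n m) (lev : Fin m → ℕ) (r : ℕ → ℕ),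
        (IsAffine N ∧ IsAffine M ∧ perPoly (Fin n) ℂ = (N ^ (n - 1) * M).trace ∧
          (∀ i j : Fin m, lev j < lev i → N i j = 0) ∧ ∀ l : ℕ, (diagBlock N lev l) ^ (r l) = 0) ∧
        ∑ u : Fin m, r (lev u) ≤ C * m) :
    ∃ C n₀ : ℕ, ∀ n ≥ n₀, ∀ m : ℕ, DualUnipotentRepr n m →
      ∃ m' : ℕ, m' ≤ C * m ∧ ∃ (N M : AffMat n m'), IsAffine N ∧ IsAffine M ∧
        (∀ i j : Fin m', j ≤ i → N i j = 0) ∧ perPoly (Fin n) ℂ = (N ^ (n - 1) * M).trace := by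
  obtain ⟨C, n₀, hC⟩ := h
  refine ⟨C, n₀, fun n hn m hrep => ?_⟩
  obtain ⟨N, M, lev, r, ⟨hN, hM, hper, hup, hnil⟩, hmass⟩ := hC n hn m hrep
  obtain ⟨N', M', hN', hM', htri, htr⟩ := exists_strictUpper_unfolding (n - 1) N M lev r hN hM hup hnil
  exact ⟨_, hmass, N', M', hN', hM', htri, hper.trans htr.symm⟩

/-- **U2′ → rung.**  Width saving `≤ C` closes the 3/2 rung with constant `144·C²`: the strictly upper triangular
representation of width `m′ ≤ C·m` obeys the landed triangularisable rung `n³ ≤ 144·m′²` (`cube_le_of_strictLevel`,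
level function `u ↦ u`). [folklore] -/
theorem dualUnipotentThreeHalves_of_strictUpperWidthSaving
    (h : ∃ C n₀ : ℕ, ∀ n ≥ n₀, ∀ m : ℕ, DualUnipotentRepr n m →
      ∃ m' : ℕ, m' ≤ C * m ∧ ∃ (N M : AffMat n m'), IsAffine N ∧ IsAffine M ∧
        (∀ i j : Fin m', j ≤ i → N i j = 0) ∧ perPoly (Fin n) ℂ = (N ^ (n - 1) * M).trace) :
    DualUnipotentThreeHalves := by
  obtain ⟨C, n₀, hC⟩ := h
  refine ⟨144 * C ^ 2, max n₀ 4, fun n hn m hrep => ?_⟩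
  have hn₀ : n₀ ≤ n := le_trans (le_max_left _ _) hn
  have hn4 : 4 ≤ n := le_trans (le_max_right _ _) hn
  obtain ⟨m', hm', N, M, hN, hM, htri, hper⟩ := hC n hn₀ m hrep
  have hstrict : ∀ u v : Fin m', N u v ≠ 0 → (u : ℕ) < (v : ℕ) := by
    intro u v huv
    by_contra hle
    exact huv (htri u v (Fin.le_def.mpr (not_lt.mp hle)))
  have hcube : n ^ 3 ≤ 144 * m' ^ 2 := cube_le_of_strictLevel hn4 N M (fun u => (u : ℕ)) hN hM hstrict hper
  have hsq : m' ^ 2 ≤ (C * m) ^ 2 := Nat.pow_le_pow_left hm' 2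
  calc n ^ 3 ≤ 144 * m' ^ 2 := hcube
    _ ≤ 144 * (C * m) ^ 2 := Nat.mul_le_mul_left _ hsq
    _ = 144 * C ^ 2 * m ^ 2 := by ring

/-- **U2 → rung (Theorems-side copy of the skeleton's chain), factored through U2′.** [folklore] -/
theorem dualUnipotentThreeHalves_of_cheapIndexMass'
    (h : ∃ C n₀ : ℕ, ∀ n ≥ n₀, ∀ m : ℕ, DualUnipotentRepr n m →
      ∃ (N M : AffMat n m) (lev : Fin m → ℕ) (r : ℕ → ℕ),
        (IsAffine N ∧ IsAffine M ∧ perPoly (Fin n) ℂ = (N ^ (n - 1) * M).trace ∧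
          (∀ i j : Fin m, lev j < lev i → N i j = 0) ∧ ∀ l : ℕ, (diagBlock N lev l) ^ (r l) = 0) ∧
        ∑ u : Fin m, r (lev u) ≤ C * m) :
    DualUnipotentThreeHalves :=
  dualUnipotentThreeHalves_of_strictUpperWidthSaving (strictUpperWidthSaving_of_cheapIndexMass h)

end Summit.ValiantsHypothesis.ValiantsHypothesis.Theorems.DualUnipotentThreeHalvesNegative

end
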